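import Literature.Probability.Percolation.CardyFormula
import Literature.Probability.Percolation.RSWProofs
import Literature.Probability.Percolation.FourArmGarbanSquareDomain
import Mathlib.Analysis.Complex.ReImTopology

/-!
# Rectangle duality for bond-ℤ² crossing limits, part 1: the discretised box `(0, w) × (0, 1)`

Support file for stub `stub_rectangleDuality` (stub D) of line `registered` of crux
`SimilarityUpgrade` (stmt-CriticalPhenomena-4597, route `CardyWhiteToColoured`, sub-problem
`CardyFormulaZ2`): for full bond-ℤ² crossing limits `Φ`, `Φ (Q w₀) + Φ (Q' w₀) = 1` for the
left–right and bottom–top marked boxes `(0, w₀) × (0, 1)`.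

The open box `Ω = (0, w) × (0, 1)` (written `Ioo 0 w ×ℂ Ioo 0 1`) under the tree's discretisation
recipe (`meshVertices`, `meshDomain` = largest mesh component, `discreteDomainGraph`,
`meshBoundary`, `discreteArc`; Smirnov 2001, §2) at a mesh `δ > 0` with `δ (b + 2) = 1` and
`δ (a + 1) < w ≤ δ (a + 2)` (`a b : ℕ`):

* the mesh vertices are the lattice box `[1, a + 1] × [1, b + 1]` (`mem_meshVertices_box_iff`),
  the mesh graph of the box is connected, so `meshDomain Ω δ = meshVertices Ω δ`
  (`meshDomain_box`), and `Ω_δ` is the nearest-neighbour graph on the lattice box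
  (`discreteDomainGraph_adj_box`);
* the frontier of the box is the union of its four closed sides (`mem_frontier_box`); the feet of
  the perpendiculars from a mesh vertex lie on it (`feet_mem_frontier`), within `δ` of a rim
  vertex (`foot_left`, `foot_right`, `foot_bottom`, `foot_top`).

Adapted from `Theorems/CardyBoundaryCoulombGasHalfPlaneMarkDensityLawBoxExhaustionPart1.lean`
(the box `(-K, K) × (0, H)` there). No definitions are introduced.
-/

noncomputable section

namespace Summit.CriticalPhenomena.CardyFormulaZ2.Cruxes.SimilarityUpgrade.Stubs

open Set Metric Complex MeasureTheory Filter Topology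
open Literature.Probability.LatticeModels Literature.Probability.Percolation
open Literature.Probability.RandomPlanarGeometry (ConformalRectangle)

variable {w δ : ℝ}

namespace RectangleDuality

/-! ## The box and its mesh vertices -/

/-- Membership in the box `(0, w) × (0, 1)`. [folklore] -/
theorem mem_box {z : ℂ} :
    z ∈ Ioo (0 : ℝ) w ×ℂ Ioo (0 : ℝ) 1 ↔ (0 < z.re ∧ z.re < w) ∧ (0 < z.im ∧ z.im < 1) := by
  simp [mem_reProdIm]

/-- The box is convex. [folklore] -/
theorem convex_box : Convex ℝ (Ioo (0 : ℝ) w ×ℂ Ioo (0 : ℝ) 1) :=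
  ((convex_Ioo _ _).linear_preimage reLm).inter ((convex_Ioo _ _).linear_preimage imLm)

/-- Mesh vertices of the box (real form). [folklore] -/
theorem mem_meshVertices_box {v : Site 2} :
    v ∈ meshVertices (Ioo (0 : ℝ) w ×ℂ Ioo (0 : ℝ) 1) δ ↔
      (0 < δ * v 0 ∧ δ * v 0 < w) ∧ (0 < δ * v 1 ∧ δ * v 1 < 1) := by
  rw [mem_meshVertices_iff, mem_box, meshPoint_re, meshPoint_im]

/-- An integer `m` has `0 < δ m < t` iff `1 ≤ m ≤ c + 1`, when `δ (c + 1) < t ≤ δ (c + 2)`.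
[folklore] -/
theorem window_iff (hδ : 0 < δ) {c : ℕ} {t : ℝ} (h1 : δ * (c + 1) < t) (h2 : t ≤ δ * (c + 2))
    (m : ℤ) : (0 < δ * m ∧ δ * m < t) ↔ (1 ≤ m ∧ m ≤ c + 1) := by
  constructor
  · rintro ⟨h3, h4⟩
    have h5 : (0 : ℝ) < m := pos_of_mul_pos_right h3 hδ.le
    have h6 : (m : ℝ) < c + 2 := by
      by_contra h
      push Not at h
      have := mul_le_mul_of_nonneg_left h hδ.le
      linarith
    have h5' : (0 : ℤ) < m := by exact_mod_cast h5
    have h6' : m < (c : ℤ) + 2 := by exact_mod_cast h6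
    omega
  · rintro ⟨h3, h4⟩
    have h3' : (1 : ℝ) ≤ m := by exact_mod_cast h3
    have h4' : (m : ℝ) ≤ c + 1 := by exact_mod_cast h4
    refine ⟨mul_pos hδ (by linarith), ?_⟩
    calc δ * m ≤ δ * (c + 1) := mul_le_mul_of_nonneg_left h4' hδ.le
      _ < t := h1

/-- From `δ (b + 2) = 1`: `δ (b + 1) < 1`. [folklore] -/
theorem row_lt_one (hδ : 0 < δ) {b : ℕ} (hb : δ * (b + 2) = 1) : δ * (b + 1) < 1 := by
  nlinarith

/-- **Mesh vertices of the box (integer form)**: the lattice box `[1, a + 1] × [1, b + 1]`.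
[folklore] -/
theorem mem_meshVertices_box_iff (hδ : 0 < δ) {a b : ℕ} (ha : δ * (a + 1) < w)
    (ha' : w ≤ δ * (a + 2)) (hb : δ * (b + 2) = 1) {v : Site 2} :
    v ∈ meshVertices (Ioo (0 : ℝ) w ×ℂ Ioo (0 : ℝ) 1) δ ↔
      (1 ≤ v 0 ∧ v 0 ≤ a + 1) ∧ (1 ≤ v 1 ∧ v 1 ≤ b + 1) := by
  rw [mem_meshVertices_box, window_iff hδ ha ha', window_iff hδ (row_lt_one hδ hb) hb.symm.le]

/-- Lattice neighbours inside the box are mesh-adjacent (the box is convex). [folklore] -/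
theorem meshGraph_adj_box {x y : Site 2} (hx : x ∈ meshVertices (Ioo (0 : ℝ) w ×ℂ Ioo (0 : ℝ) 1) δ)
    (hy : y ∈ meshVertices (Ioo (0 : ℝ) w ×ℂ Ioo (0 : ℝ) 1) δ) (hxy : (zdGraph 2).Adj x y) :
    (meshGraph (Ioo (0 : ℝ) w ×ℂ Ioo (0 : ℝ) 1) δ).Adj x y :=
  meshGraph_adj_iff.2 ⟨hxy, (convex_box.segment_subset hx hy).trans subset_closure⟩

/-- Stepping down one column stays in the box when the column index is at least `2`. [folklore] -/
theorem sub_single_zero_mem (hδ : 0 < δ) {v : Site 2}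
    (hv : v ∈ meshVertices (Ioo (0 : ℝ) w ×ℂ Ioo (0 : ℝ) 1) δ) (h2 : 2 ≤ v 0) :
    v - Pi.single 0 1 ∈ meshVertices (Ioo (0 : ℝ) w ×ℂ Ioo (0 : ℝ) 1) δ := by
  rw [mem_meshVertices_box] at hv ⊢
  have h2' : (2 : ℝ) ≤ v 0 := by exact_mod_cast h2
  simp only [Pi.sub_apply, Pi.single_eq_same, Int.cast_sub, Int.cast_one, ne_eq, one_ne_zero,
    not_false_eq_true, Pi.single_eq_of_ne, sub_zero]
  refine ⟨⟨mul_pos hδ (by linarith), lt_of_le_of_lt ?_ hv.1.2⟩, hv.2⟩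
  exact mul_le_mul_of_nonneg_left (by linarith) hδ.le

/-- Stepping down one row stays in the box when the row index is at least `2`. [folklore] -/
theorem sub_single_one_mem (hδ : 0 < δ) {v : Site 2}
    (hv : v ∈ meshVertices (Ioo (0 : ℝ) w ×ℂ Ioo (0 : ℝ) 1) δ) (h2 : 2 ≤ v 1) :
    v - Pi.single 1 1 ∈ meshVertices (Ioo (0 : ℝ) w ×ℂ Ioo (0 : ℝ) 1) δ := by
  rw [mem_meshVertices_box] at hv ⊢
  have h2' : (2 : ℝ) ≤ v 1 := by exact_mod_cast h2
  simp only [Pi.sub_apply, Pi.single_eq_same, Int.cast_sub, Int.cast_one, ne_eq, zero_ne_one,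
    not_false_eq_true, Pi.single_eq_of_ne, sub_zero]
  refine ⟨hv.1, mul_pos hδ (by linarith), lt_of_le_of_lt ?_ hv.2.2⟩
  exact mul_le_mul_of_nonneg_left (by linarith) hδ.le

/-- Every mesh vertex of the box has positive integer coordinates. [folklore] -/
theorem one_le_of_mem (hδ : 0 < δ) {v : Site 2}
    (hv : v ∈ meshVertices (Ioo (0 : ℝ) w ×ℂ Ioo (0 : ℝ) 1) δ) : 1 ≤ v 0 ∧ 1 ≤ v 1 := by
  rw [mem_meshVertices_box] at hv
  have h0 : (0 : ℝ) < v 0 := pos_of_mul_pos_right hv.1.1 hδ.le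
  have h1 : (0 : ℝ) < v 1 := pos_of_mul_pos_right hv.2.1 hδ.le
  have h0' : (0 : ℤ) < v 0 := by exact_mod_cast h0
  have h1' : (0 : ℤ) < v 1 := by exact_mod_cast h1
  omega

/-- If the box has a mesh vertex, the corner site `(1, 1)` is a mesh vertex. [folklore] -/
theorem corner_mem (hδ : 0 < δ) {v : Site 2}
    (hv : v ∈ meshVertices (Ioo (0 : ℝ) w ×ℂ Ioo (0 : ℝ) 1) δ) :
    (![1, 1] : Site 2) ∈ meshVertices (Ioo (0 : ℝ) w ×ℂ Ioo (0 : ℝ) 1) δ := by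
  have h := one_le_of_mem hδ hv
  rw [mem_meshVertices_box] at hv ⊢
  have h0 : (1 : ℝ) ≤ v 0 := by exact_mod_cast h.1
  have h1 : (1 : ℝ) ≤ v 1 := by exact_mod_cast h.2
  simp only [Matrix.cons_val_zero, Matrix.cons_val_one, Int.cast_one, mul_one]
  refine ⟨⟨hδ, lt_of_le_of_lt ?_ hv.1.2⟩, hδ, lt_of_le_of_lt ?_ hv.2.2⟩
  · simpa using mul_le_mul_of_nonneg_left h0 hδ.le
  · simpa using mul_le_mul_of_nonneg_left h1 hδ.le

/-- **The mesh graph of the box is connected**: every mesh vertex is joined to the corner `(1, 1)`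
by column and row moves towards it. [folklore] -/
theorem reachable_corner (hδ : 0 < δ) :
    ∀ (n : ℕ) (v : Site 2) (hv : v ∈ meshVertices (Ioo (0 : ℝ) w ×ℂ Ioo (0 : ℝ) 1) δ)
      (hc : (![1, 1] : Site 2) ∈ meshVertices (Ioo (0 : ℝ) w ×ℂ Ioo (0 : ℝ) 1) δ),
      v 0 + v 1 ≤ n + 2 →
      (meshVertexGraph (Ioo (0 : ℝ) w ×ℂ Ioo (0 : ℝ) 1) δ).Reachable ⟨v, hv⟩ ⟨![1, 1], hc⟩ := by
  intro n
  induction n with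
  | zero =>
    intro v hv hc hsum
    have h := one_le_of_mem hδ hv
    have e : v = ![1, 1] := by
      ext i; fin_cases i
      · show v 0 = 1; simp at hsum; omega
      · show v 1 = 1; simp at hsum; omega
    subst e
    rfl
  | succ n ih =>
    intro v hv hc hsum
    by_cases hle : v 0 + v 1 ≤ n + 2
    · exact ih v hv hc hle
    have h := one_le_of_mem hδ hv
    by_cases h0 : 2 ≤ v 0
    · have hv' := sub_single_zero_mem hδ hv h0
      refine (SimpleGraph.Adj.reachable (?_ : (meshVertexGraph _ δ).Adj ⟨v, hv⟩ ⟨_, hv'⟩)).trans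
        (ih _ hv' hc ?_)
      · simp only [SimpleGraph.comap_adj, Function.Embedding.coe_subtype]
        refine meshGraph_adj_box hv hv' ((zdGraph_adj_iff _ _).2 ⟨0, Or.inr ?_⟩)
        simp
      · simp only [Pi.sub_apply, Pi.single_eq_same, ne_eq, one_ne_zero, not_false_eq_true,
          Pi.single_eq_of_ne, sub_zero]
        push_cast at hsum ⊢
        omega
    · have h1 : 2 ≤ v 1 := by push_cast at hsum; omega
      have hv' := sub_single_one_mem hδ hv h1
      refine (SimpleGraph.Adj.reachable (?_ : (meshVertexGraph _ δ).Adj ⟨v, hv⟩ ⟨_, hv'⟩)).trans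
        (ih _ hv' hc ?_)
      · simp only [SimpleGraph.comap_adj, Function.Embedding.coe_subtype]
        refine meshGraph_adj_box hv hv' ((zdGraph_adj_iff _ _).2 ⟨1, Or.inr ?_⟩)
        simp
      · simp only [Pi.sub_apply, Pi.single_eq_same, ne_eq, zero_ne_one, not_false_eq_true,
          Pi.single_eq_of_ne, sub_zero]
        push_cast at hsum ⊢
        omega

/-- The mesh graph of the box on its mesh vertices is preconnected. [folklore] -/
theorem preconnected_meshVertexGraph_box (hδ : 0 < δ) :
    (meshVertexGraph (Ioo (0 : ℝ) w ×ℂ Ioo (0 : ℝ) 1) δ).Preconnected := by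
  rintro ⟨u, hu⟩ ⟨v, hv⟩
  have hc := corner_mem hδ hu
  have h1 := one_le_of_mem hδ hu
  have h2 := one_le_of_mem hδ hv
  have hu' := reachable_corner hδ (u 0 + u 1 - 2).toNat u hu hc (by omega)
  have hv' := reachable_corner hδ (v 0 + v 1 - 2).toNat v hv hc (by omega)
  exact hu'.trans hv'.symm

/-- **The discrete box is the whole lattice box**: `meshDomain = meshVertices` (tree:
`meshDomain_eq_meshVertices_of_preconnected`). [folklore] -/
theorem meshDomain_box (hδ : 0 < δ) :
    meshDomain (Ioo (0 : ℝ) w ×ℂ Ioo (0 : ℝ) 1) δ = meshVertices (Ioo (0 : ℝ) w ×ℂ Ioo (0 : ℝ) 1) δ :=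
  meshDomain_eq_meshVertices_of_preconnected (preconnected_meshVertexGraph_box hδ)

/-- Adjacency in `Ω_δ` for the box is lattice adjacency between mesh vertices. [folklore] -/
theorem discreteDomainGraph_adj_box (hδ : 0 < δ) {x y : Site 2} :
    (discreteDomainGraph (Ioo (0 : ℝ) w ×ℂ Ioo (0 : ℝ) 1) δ).Adj x y ↔
      (zdGraph 2).Adj x y ∧ x ∈ meshVertices (Ioo (0 : ℝ) w ×ℂ Ioo (0 : ℝ) 1) δ ∧
        y ∈ meshVertices (Ioo (0 : ℝ) w ×ℂ Ioo (0 : ℝ) 1) δ := by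
  rw [discreteDomainGraph_adj_iff, meshDomain_box hδ]
  constructor
  · rintro ⟨h, hx, hy⟩; exact ⟨(meshGraph_adj_iff.1 h).1, hx, hy⟩
  · rintro ⟨h, hx, hy⟩; exact ⟨meshGraph_adj_box hx hy h, hx, hy⟩

/-- Adjacency in the graph of open edges of `Ω_δ`, for the box. [folklore] -/
theorem open_inf_adj_box (hδ : 0 < δ) {ω : BondConfig (Site 2)} {x y : Site 2} :
    (openGraph ω ⊓ discreteDomainGraph (Ioo (0 : ℝ) w ×ℂ Ioo (0 : ℝ) 1) δ).Adj x y ↔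
      s(x, y) ∈ ω ∧ (zdGraph 2).Adj x y ∧ x ∈ meshVertices (Ioo (0 : ℝ) w ×ℂ Ioo (0 : ℝ) 1) δ ∧
        y ∈ meshVertices (Ioo (0 : ℝ) w ×ℂ Ioo (0 : ℝ) 1) δ := by
  rw [SimpleGraph.inf_adj, openGraph_adj, discreteDomainGraph_adj_box hδ]
  constructor
  · rintro ⟨⟨h1, -⟩, h2, h3, h4⟩; exact ⟨h1, h2, h3, h4⟩
  · rintro ⟨h1, h2, h3, h4⟩; exact ⟨⟨h1, h2.ne⟩, h2, h3, h4⟩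

/-! ## The frontier of the box and distances to its sides -/

/-- The frontier of the box: the four closed sides. [folklore] -/
theorem mem_frontier_box (hw : 0 < w) {q : ℂ} :
    q ∈ frontier (Ioo (0 : ℝ) w ×ℂ Ioo (0 : ℝ) 1) ↔
      (q.re ∈ Icc 0 w ∧ (q.im = 0 ∨ q.im = 1)) ∨ ((q.re = 0 ∨ q.re = w) ∧ q.im ∈ Icc (0 : ℝ) 1) := by
  rw [frontier_reProdIm, closure_Ioo hw.ne, frontier_Ioo one_pos, closure_Ioo one_pos.ne,
    frontier_Ioo hw]
  simp [mem_reProdIm]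

/-- Distance between two points on a horizontal line. [folklore] -/
theorem dist_mk_re (x y x' : ℝ) : dist (⟨x, y⟩ : ℂ) ⟨x', y⟩ = |x - x'| := by
  rw [dist_of_im_eq (z := (⟨x, y⟩ : ℂ)) (w := ⟨x', y⟩) rfl, Real.dist_eq]

/-- Distance between two points on a vertical line. [folklore] -/
theorem dist_mk_im (x y y' : ℝ) : dist (⟨x, y⟩ : ℂ) ⟨x, y'⟩ = |y - y'| := by
  rw [dist_of_re_eq (z := (⟨x, y⟩ : ℂ)) (w := ⟨x, y'⟩) rfl, Real.dist_eq]

/-- The four feet of the perpendiculars from a point of the closed box lie on the frontier.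
[folklore] -/
theorem feet_mem_frontier (hw : 0 < w) {x y : ℝ} (hx : x ∈ Icc 0 w) (hy : y ∈ Icc (0 : ℝ) 1) :
    (⟨0, y⟩ : ℂ) ∈ frontier (Ioo (0 : ℝ) w ×ℂ Ioo (0 : ℝ) 1) ∧
      (⟨w, y⟩ : ℂ) ∈ frontier (Ioo (0 : ℝ) w ×ℂ Ioo (0 : ℝ) 1) ∧
      (⟨x, 0⟩ : ℂ) ∈ frontier (Ioo (0 : ℝ) w ×ℂ Ioo (0 : ℝ) 1) ∧
      (⟨x, 1⟩ : ℂ) ∈ frontier (Ioo (0 : ℝ) w ×ℂ Ioo (0 : ℝ) 1) := by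
  refine ⟨(mem_frontier_box hw).2 ?_, (mem_frontier_box hw).2 ?_, (mem_frontier_box hw).2 ?_,
    (mem_frontier_box hw).2 ?_⟩
  · exact Or.inr ⟨Or.inl rfl, hy⟩
  · exact Or.inr ⟨Or.inr rfl, hy⟩
  · exact Or.inl ⟨hx, Or.inl rfl⟩
  · exact Or.inl ⟨hx, Or.inr rfl⟩

/-- Coordinates of a mesh vertex of the box lie in the closed box, and the box is non-degenerate.
[folklore] -/
theorem coords_of_mem (hδ : 0 < δ) {a b : ℕ} (ha : δ * (a + 1) < w) (ha' : w ≤ δ * (a + 2))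
    (hb : δ * (b + 2) = 1) {v : Site 2} (hv : v ∈ meshVertices (Ioo (0 : ℝ) w ×ℂ Ioo (0 : ℝ) 1) δ) :
    0 < w ∧ (δ ≤ δ * v 0 ∧ δ * v 0 ≤ δ * (a + 1)) ∧ (δ ≤ δ * v 1 ∧ δ * v 1 ≤ δ * (b + 1)) ∧
      (δ * v 0) ∈ Icc 0 w ∧ (δ * v 1) ∈ Icc (0 : ℝ) 1 := by
  rw [mem_meshVertices_box_iff hδ ha ha' hb] at hv
  obtain ⟨⟨h1, h2⟩, h3, h4⟩ := hv
  have h1' : (1 : ℝ) ≤ v 0 := by exact_mod_cast h1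
  have h2' : (v 0 : ℝ) ≤ a + 1 := by exact_mod_cast h2
  have h3' : (1 : ℝ) ≤ v 1 := by exact_mod_cast h3
  have h4' : (v 1 : ℝ) ≤ b + 1 := by exact_mod_cast h4
  have hw : 0 < w := lt_of_le_of_lt (by positivity) ha
  have e0 : δ ≤ δ * v 0 := by simpa using mul_le_mul_of_nonneg_left h1' hδ.le
  have e1 : δ * v 0 ≤ δ * (a + 1) := mul_le_mul_of_nonneg_left h2' hδ.le
  have e2 : δ ≤ δ * v 1 := by simpa using mul_le_mul_of_nonneg_left h3' hδ.le
  have e3 : δ * v 1 ≤ δ * (b + 1) := mul_le_mul_of_nonneg_left h4' hδ.le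
  have hb1 := row_lt_one hδ hb
  exact ⟨hw, ⟨e0, e1⟩, ⟨e2, e3⟩, ⟨by linarith, by linarith⟩, ⟨by linarith, by linarith⟩⟩

/-! ## Feet of rim vertices -/

/-- Foot of a first-column vertex on the left side. [folklore] -/
theorem foot_left (hδ : 0 < δ) {a b : ℕ} (ha : δ * (a + 1) < w) (ha' : w ≤ δ * (a + 2))
    (hb : δ * (b + 2) = 1) {v : Site 2} (hv : v ∈ meshVertices (Ioo (0 : ℝ) w ×ℂ Ioo (0 : ℝ) 1) δ)
    (h : v 0 = 1) :
    (⟨0, δ * v 1⟩ : ℂ) ∈ frontier (Ioo (0 : ℝ) w ×ℂ Ioo (0 : ℝ) 1) ∧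
      dist (⟨δ * v 0, δ * v 1⟩ : ℂ) ⟨0, δ * v 1⟩ ≤ δ := by
  obtain ⟨hw, -, -, hre, him⟩ := coords_of_mem hδ ha ha' hb hv
  refine ⟨(feet_mem_frontier hw hre him).1, ?_⟩
  have h' : (v 0 : ℝ) = 1 := by exact_mod_cast h
  rw [dist_mk_re, h', mul_one, sub_zero, abs_of_pos hδ]

/-- Foot of a last-column vertex on the right side. [folklore] -/
theorem foot_right (hδ : 0 < δ) {a b : ℕ} (ha : δ * (a + 1) < w) (ha' : w ≤ δ * (a + 2))
    (hb : δ * (b + 2) = 1) {v : Site 2} (hv : v ∈ meshVertices (Ioo (0 : ℝ) w ×ℂ Ioo (0 : ℝ) 1) δ)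
    (h : v 0 = a + 1) :
    (⟨w, δ * v 1⟩ : ℂ) ∈ frontier (Ioo (0 : ℝ) w ×ℂ Ioo (0 : ℝ) 1) ∧
      dist (⟨δ * v 0, δ * v 1⟩ : ℂ) ⟨w, δ * v 1⟩ ≤ δ := by
  obtain ⟨hw, -, -, hre, him⟩ := coords_of_mem hδ ha ha' hb hv
  refine ⟨(feet_mem_frontier hw hre him).2.1, ?_⟩
  have h' : (v 0 : ℝ) = a + 1 := by exact_mod_cast h
  rw [dist_mk_re, h', abs_le]
  constructor <;> linarith

/-- Foot of a first-row vertex on the bottom side. [folklore] -/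
theorem foot_bottom (hδ : 0 < δ) {a b : ℕ} (ha : δ * (a + 1) < w) (ha' : w ≤ δ * (a + 2))
    (hb : δ * (b + 2) = 1) {v : Site 2} (hv : v ∈ meshVertices (Ioo (0 : ℝ) w ×ℂ Ioo (0 : ℝ) 1) δ)
    (h : v 1 = 1) :
    (⟨δ * v 0, 0⟩ : ℂ) ∈ frontier (Ioo (0 : ℝ) w ×ℂ Ioo (0 : ℝ) 1) ∧
      dist (⟨δ * v 0, δ * v 1⟩ : ℂ) ⟨δ * v 0, 0⟩ ≤ δ := by
  obtain ⟨hw, -, -, hre, him⟩ := coords_of_mem hδ ha ha' hb hv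
  refine ⟨(feet_mem_frontier hw hre him).2.2.1, ?_⟩
  have h' : (v 1 : ℝ) = 1 := by exact_mod_cast h
  rw [dist_mk_im, h', mul_one, sub_zero, abs_of_pos hδ]

/-- Foot of a last-row vertex on the top side. [folklore] -/
theorem foot_top (hδ : 0 < δ) {a b : ℕ} (ha : δ * (a + 1) < w) (ha' : w ≤ δ * (a + 2))
    (hb : δ * (b + 2) = 1) {v : Site 2} (hv : v ∈ meshVertices (Ioo (0 : ℝ) w ×ℂ Ioo (0 : ℝ) 1) δ)
    (h : v 1 = b + 1) :
    (⟨δ * v 0, 1⟩ : ℂ) ∈ frontier (Ioo (0 : ℝ) w ×ℂ Ioo (0 : ℝ) 1) ∧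
      dist (⟨δ * v 0, δ * v 1⟩ : ℂ) ⟨δ * v 0, 1⟩ ≤ δ := by
  obtain ⟨hw, -, -, hre, him⟩ := coords_of_mem hδ ha ha' hb hv
  refine ⟨(feet_mem_frontier hw hre him).2.2.2, ?_⟩
  have h' : (v 1 : ℝ) = b + 1 := by exact_mod_cast h
  rw [dist_mk_im, h', abs_le]
  constructor <;> linarith

end RectangleDuality

/-- Registered stub of this support file (part 1 of the rectangle duality): the discrete box is
the whole lattice box. [folklore] -/
theorem stub_rectangleDuality_meshDomain :
    ∀ w δ : ℝ, 0 < δ →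
      meshDomain (Ioo (0 : ℝ) w ×ℂ Ioo (0 : ℝ) 1) δ = meshVertices (Ioo (0 : ℝ) w ×ℂ Ioo (0 : ℝ) 1) δ :=
  fun _ _ hδ => RectangleDuality.meshDomain_box hδ

end Summit.CriticalPhenomena.CardyFormulaZ2.Cruxes.SimilarityUpgrade.Stubs

end
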